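import Literature.MathematicalPhysics.QuantumFieldTheory.Balaban1983to89.B9Letters313AtOneL2

/-!
# `Balaban1983to89.B9Letters313AtOneL2Qflat` — [B9] Thm 3.13's BLOCK-L² reduction letters AT THE TRIVIAL BACKGROUND, fifth batch: the averaging
# letter `Letters313L2PZ.q` (`‖1_{Δ′(y)}Q(1)λ‖ ≤ B₄·(√wZ y·Lʲη·(L^{j′}η)⁻¹)·e^{−δd}‖λ‖`) HOLDS AT `U = 1`, uniformly (no census needed)

T. Bałaban, *Propagators for lattice gauge theories in a background field*, Commun. Math. Phys. **99** (1985) 389–434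
[`Balaban1985BackgroundPropagators`, "B9"]; [4] = T. Bałaban, *Propagators and renormalization transformations for lattice gauge
theories. II*, Commun. Math. Phys. **96** (1984) 223–250 [`Balaban1984PropagatorsII`]; [3] = part I, Commun. Math. Phys. **95** (1984) 17–40
[`Balaban1984PropagatorsI`].

statement-level skeleton of published theorems with citation tags; proofs where landed; nothing here is a claim about the Yang–Mills mass gap

THE PRINTED LOCI (verbatim).  [B9] p. 426 (Thm 3.13: the letters include `Q(U)`), (3.13)–(3.15) p. 393, (3.46) p. 398, Cor. 3.5 p. 407; [3] (1.18)
p. 20 (the averaging weights, `≥ 0`, total mass one); [4] (2.18)–(2.20) p. 226, (2.45)–(2.46) p. 231, (2.60) p. 234.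

THE POINT.  dag-n06-d's certificate (ed. 22) displays `hLL2 : Letters313L2PZ (𝔬12 x) … (√wZ) … U ∧ …` whose field `q` is the block-L² bound of
the averaging operator `Q(U) : 𝔠 → 𝔠_Z`, `BlockBd blk blkZ (Q U)(B₄·(vZ y·|Δ(y)|·|Δ(y′)|⁻¹)·e^{−δd})`, and pins `Q` by `hQco12 : (𝔬12 x).Q U = QcoKH …
(parBY x) U`.  THIS FILE inhabits `q` at `U ↦ 1`: at a configuration reading `1` the pinned `Q` is `(cR39 b)⁻¹ •` the mixed model of the flat
kernel `Q♭` (this seat's g0 `B9Letters313AtOneQ.QcoKH_one ∕ liftMatY_qK_liftY`), and `Q♭` from fine-bond functions (block map `bI`, 1-faithful)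
to index-bond functions (identity block map) satisfies the scalar block-L² bound ★★ `blockBd_qK_bI` — Cauchy–Schwarz with the weights of total
mass one and `max q_y ≤ (L^{(d+1)j(y)})⁻¹ = wZ y` (`abs_qK_mulVec_le_l2`), locality `q_y(f) ≠ 0 ⇒ d(y, bI f) ≤ ℓ + 4`, and ONE transfer (2.60)
turning the constant into the printed `Lʲη·(L^{j′}η)⁻¹` — whence ★★★ `blockBd_Q_one` (pins `hQco12 ∕ hblk12 ∕ hblkZ12`) through
`B9Letters313AtOneL2.blockBd_coordOpKH_of_liftY`, and ★★★ `letters313_L2_q_one_kIdx` (uniformly: every `δ ≥ 0`, threshold `log L ≤ M`).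

HONEST SCOPE.  A READING file, inputs cited by name; nothing of [B9] at curved `U` asserted; `hLL2` NOT witnessed (A6 partial witnesses at `U = 1`).
COUNT-NEUTRAL; N06 NOT discharged; one finite lattice at a time; nothing continuum, nothing about the mass gap.
Cell `pub-ymgap` (HUMAN RULING D-0062 ∕ D-0149), node N06 [B9], rows 20–21 JSAT lane, width seat `pub-ymgap-dag-n06-w3` (g2), 2026-08-28.
-/

noncomputable section

namespace Literature.MathematicalPhysics.QuantumFieldTheory.Balaban1983to89.B9Letters313AtOneL2Qflat

open B6Geom246MultiLevelTorus (geomT) open B6GlobalChartV1 (PV blkV1)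
open B6KLevelCensusIndexV1 (KIdx kGeo kGeoG) open B6Ineq2142KLevelV1 (lvl β qwt qwt_le qwt_nonneg) open B9GeoNormsKLevelV1 (geo9K)
open B9GeoLemma21KLevelV1 (one_le_Mh geo9K_len_pos geo9K_dist_comm geo9K_M_nonneg geo9K_one_le_L) open B9Thm39ReadingCoords (cR39 cR39_nonneg)
open B9CoReadingCoords B9CoReadingCoordsH open B9Thm34Ext (toB6) open B9SectDL2Decay (bsq bl2 BlockBd bsq_nonneg bl2_nonneg sum_bsq bsq_eq_zero_of_loc)
open B9Eq3132Ineq2142Covariant (qK_apply sum_qwt_eq_one) open B9LettersHZAtOne (plateau_pos)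
open B9Letters313AtOneQ (qK_mulVec_apply dist_le_of_qwt_ne_zero_bI QcoKH_one liftMatY_qK_liftY len_pow_le_of_transfer transfer_threshold)
open B9Letters313AtOneL2 (blockBd_coordOpKH_of_liftY blockBd_smul_of_nonneg)
open Node00 Node00.OpsYSectDCoords B9Thm312Whole
open scoped Matrix

variable {d ℓ : ℕ} {hd : 1 ≤ d + 1} {hL : Odd (ℓ + 1) ∧ 1 < ℓ + 1} {b₀ b₁ : ℝ}

/-! ## §1 The flat averaging kernel `Q♭` in block-L²: Cauchy–Schwarz with weights of mass one, locality, one transfer -/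

section Flat

variable (i : KIdx d ℓ hd hL b₀ b₁) {bI : FBondY i → IBondY i}

/-- **`|(Q♭μ)(y)| ≤ √(wZ y)·‖μ‖₂`**: `(Σ_f q_y(f)μ(f))² ≤ (Σ_f q_y(f)²)(Σ_f μ(f)²) ≤ (max_f q_y(f))·(Σ_f q_y(f))·Σ_f μ(f)² = wZ y·Σ_f μ(f)²`
(weights `≥ 0`, total mass one, `q_y(f) ≤ (L^{(d+1)j(y)})⁻¹`). [cite: Balaban1984PropagatorsI, (1.18) p.20, (1.15) p.19; Balaban1984PropagatorsII, (2.18)–(2.20) p.226] -/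
theorem abs_qK_mulVec_le_l2 (μ : FBondY i → ℝ) (y : IBondY i) :
    |(qK i *ᵥ μ) y| ≤ Real.sqrt (((((ℓ + 1 : ℕ) : ℝ) ^ (d + 1)) ^ lvl i.hN i.D i.hk y)⁻¹) * Real.sqrt (∑ f, μ f ^ 2) := by
  set pl : ℝ := ((((ℓ + 1 : ℕ) : ℝ) ^ (d + 1)) ^ lvl i.hN i.D i.hk y)⁻¹ with hpl
  have hpl0 : 0 < pl := plateau_pos i y
  have hq2 : ∑ f, qwt i.hN i.D i.hk y f ^ 2 ≤ pl := by
    calc ∑ f, qwt i.hN i.D i.hk y f ^ 2 ≤ ∑ f, pl * qwt i.hN i.D i.hk y f := Finset.sum_le_sum fun f _ => by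
          rw [sq]; exact mul_le_mul_of_nonneg_right (qwt_le i.hN i.D i.hk y f) (qwt_nonneg i.hN i.D i.hk y f)
      _ = pl := by rw [← Finset.mul_sum, sum_qwt_eq_one i y, mul_one]
  have hcs : ((qK i *ᵥ μ) y) ^ 2 ≤ pl * ∑ f, μ f ^ 2 := by
    rw [qK_mulVec_apply]
    calc (∑ f, qwt i.hN i.D i.hk y f * μ f) ^ 2 ≤ (∑ f, qwt i.hN i.D i.hk y f ^ 2) * ∑ f, μ f ^ 2 :=
          Finset.sum_mul_sq_le_sq_mul_sq _ _ _
      _ ≤ pl * ∑ f, μ f ^ 2 := mul_le_mul_of_nonneg_right hq2 (Finset.sum_nonneg fun f _ => sq_nonneg _)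
  rw [← Real.sqrt_mul hpl0.le, ← Real.sqrt_sq_eq_abs]
  exact Real.sqrt_le_sqrt hcs

/-- the total `L²` mass of a block-localised function is its size on that block. [cite: Balaban1984PropagatorsII, (2.54) p.233, bookkeeping] -/
theorem sum_sq_eq_bsq_of_loc {G : B6.Geometry} {X : Type} [Fintype X] (blk : X → G.Site) {a' : G.Site} (μ : X → ℝ)
    (hμ : ∀ x, blk x ≠ a' → μ x = 0) : ∑ x, μ x ^ 2 = bsq (g := G) blk a' μ := by
  rw [← sum_bsq (g := G) blk μ, Finset.sum_eq_single a']
  · intro y _ hy; exact bsq_eq_zero_of_loc (g := G) blk hy μ hμ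
  · intro h; exact absurd (Finset.mem_univ _) h

/-- ★★ **THE FLAT `Q` KERNEL IN BLOCK-L²** from fine-bond functions (block map `bI`, 1-faithful) to index-bond functions (identity block map), in
`geo9K`: `‖1_{y}Q♭μ‖ ≤ L·e^{(δ+ε)(ℓ+4)}·(√wZ y·|Δ(y)|·|Δ(y′)|⁻¹)·e^{−δd(y,y′)}·‖1_{Δ(y′)}μ‖` for every `δ ≥ 0`, given the transfer threshold for
`ε > 0` — `Q♭` sees only the blocks within `ℓ + 4`, where `|Δ(y′)| ≤ L·e^{εd}·|Δ(y)|` (2.60).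
[cite: Balaban1984PropagatorsII, (2.18)–(2.20) p.226, (2.45)–(2.46) p.231, (2.54) p.233, (2.60) p.234; Balaban1985BackgroundPropagators, Thm 3.13 p.426 (the letter Q), (3.46) p.398] -/
theorem blockBd_qK_bI (hG : GeoOK (geo9K i)) [Fintype (geo9K i).Site]
    (hβ1 : ∀ f : FBondY i, (geomT i.D).dist (β i.hN i.D i.hk (bI f)) (blkV1 i.hN i.D f) ≤ 1)
    {δ : ℝ} (hδ : 0 ≤ δ) {ε : ℝ} (hε : 0 < ε) (hM : Real.log (geo9K i).L ≤ ε * (2 * ((ℓ : ℝ) + 1) ^ 2 - 1) * (geo9K i).M)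
    (R₀ : ℝ) (H₀ : Prop) :
    BlockBd (g := toB6 (geo9K i) R₀ H₀) bI (fun a : IBondY i => a) (Matrix.toLin' (qK i))
      (fun y y' => (geo9K i).L * Real.exp ((δ + ε) * ((ℓ : ℝ) + 4)) *
        (Real.sqrt (((((ℓ + 1 : ℕ) : ℝ) ^ (d + 1)) ^ lvl i.hN i.D i.hk y)⁻¹) * (geo9K i).len y * ((geo9K i).len y')⁻¹) *
        Real.exp (-(δ * (geo9K i).dist y y'))) := by
  intro a' μ hμ y
  change IBondY i at y
  change IBondY i at a'
  have hbl2 : bl2 (g := toB6 (geo9K i) R₀ H₀) (fun a : IBondY i => a) y (Matrix.toLin' (qK i) μ) = |(qK i *ᵥ μ) y| := by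
    classical
    unfold bl2 bsq
    rw [Finset.sum_eq_single y]
    · simp [Real.sqrt_sq_eq_abs]
    · intro a _ ha
      split_ifs with h
      · exact absurd h ha
      · rfl
    · intro h; exact absurd (Finset.mem_univ _) h
  rw [hbl2]
  have hly : 0 < (geo9K i).len y := hG.lenpos y
  have hla : 0 < (geo9K i).len a' := hG.lenpos a'
  set v : ℝ := Real.sqrt (((((ℓ + 1 : ℕ) : ℝ) ^ (d + 1)) ^ lvl i.hN i.D i.hk y)⁻¹) with hv
  have hK0 : 0 ≤ (geo9K i).L * Real.exp ((δ + ε) * ((ℓ : ℝ) + 4)) * (v * (geo9K i).len y * ((geo9K i).len a')⁻¹) *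
      Real.exp (-(δ * (geo9K i).dist y a')) := by have := geo9K_one_le_L i; positivity
  by_cases hnear : (geo9K i).dist y a' ≤ (ℓ : ℝ) + 4
  · -- Cauchy–Schwarz, then the transfer `len a' ≤ L e^{εd} len y`
    have h1 : |(qK i *ᵥ μ) y| ≤ v * bl2 (g := toB6 (geo9K i) R₀ H₀) bI a' μ := by
      have := abs_qK_mulVec_le_l2 i μ y
      rwa [sum_sq_eq_bsq_of_loc (G := toB6 (geo9K i) R₀ H₀) bI μ hμ] at this
    have ht : (geo9K i).len a' ^ 1 ≤ (geo9K i).L ^ 1 * Real.exp (ε * (geo9K i).dist y a') * (geo9K i).len y ^ 1 :=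
      len_pow_le_of_transfer i hε 1 (by rwa [Nat.cast_one, one_mul]) y a'
    rw [pow_one, pow_one, pow_one] at ht
    have hexpε : Real.exp (ε * (geo9K i).dist y a') ≤ Real.exp (ε * ((ℓ : ℝ) + 4)) :=
      Real.exp_le_exp.2 (mul_le_mul_of_nonneg_left hnear hε.le)
    have hexpδ : 1 ≤ Real.exp (δ * ((ℓ : ℝ) + 4)) * Real.exp (-(δ * (geo9K i).dist y a')) := by
      rw [← Real.exp_add]; exact Real.one_le_exp (by nlinarith [mul_le_mul_of_nonneg_left hnear hδ])
    -- `1 ≤ L e^{ε(ℓ+4)} len y (len a')⁻¹`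
    have hratio : 1 ≤ (geo9K i).L * Real.exp (ε * ((ℓ : ℝ) + 4)) * (geo9K i).len y * ((geo9K i).len a')⁻¹ := by
      rw [le_mul_inv_iff₀ hla, one_mul]
      calc (geo9K i).len a' ≤ (geo9K i).L * Real.exp (ε * (geo9K i).dist y a') * (geo9K i).len y := ht
        _ ≤ (geo9K i).L * Real.exp (ε * ((ℓ : ℝ) + 4)) * (geo9K i).len y := by
            have := geo9K_one_le_L i; gcongr
    have hsplit : Real.exp ((δ + ε) * ((ℓ : ℝ) + 4)) = Real.exp (δ * ((ℓ : ℝ) + 4)) * Real.exp (ε * ((ℓ : ℝ) + 4)) := by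
      rw [← Real.exp_add]; congr 1; ring
    calc |(qK i *ᵥ μ) y| ≤ v * bl2 (g := toB6 (geo9K i) R₀ H₀) bI a' μ := h1
      _ = v * 1 * 1 * bl2 (g := toB6 (geo9K i) R₀ H₀) bI a' μ := by ring
      _ ≤ v * ((geo9K i).L * Real.exp (ε * ((ℓ : ℝ) + 4)) * (geo9K i).len y * ((geo9K i).len a')⁻¹) *
          (Real.exp (δ * ((ℓ : ℝ) + 4)) * Real.exp (-(δ * (geo9K i).dist y a'))) * bl2 (g := toB6 (geo9K i) R₀ H₀) bI a' μ := by
          have := bl2_nonneg (g := toB6 (geo9K i) R₀ H₀) bI a' μ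
          gcongr
      _ = _ := by rw [hsplit]; ring
  · have h0 : (qK i *ᵥ μ) y = 0 := by
      rw [qK_mulVec_apply]
      refine Finset.sum_eq_zero fun f _ => ?_
      by_cases hf : bI f = a'
      · by_cases hq : qwt i.hN i.D i.hk y f = 0
        · rw [hq, zero_mul]
        · exact absurd (hf ▸ dist_le_of_qwt_ne_zero_bI i hβ1 hq) hnear
      · rw [hμ f hf, mul_zero]
    rw [h0, abs_zero]
    exact mul_nonneg hK0 (bl2_nonneg _ _ _)

end Flat

/-! ## §2 At the pins: the letter `Letters313L2PZ.q` at `U = 1` -/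

section Letter

variable {𝔸 : Type} [NormedRing 𝔸] [NormedAlgebra ℂ 𝔸] [CompleteSpace 𝔸] [FiniteDimensional ℝ 𝔸]
variable {κ : Type} [Fintype κ]
variable (i : KIdx d ℓ hd hL b₀ b₁) (b : Module.Basis κ ℝ 𝔸) (B : B9.Backgrounds) (cfg : B.Cfg → CfgY 𝔸 i) (parB : BondParY 𝔸 i)
variable {Y W : Type}

/-- ★★★ **THE LETTER `q` OF `Letters313L2PZ` AT `U = 1`** — `‖1_{Δ′(y)}Q(U₁)λ‖ ≤ (cR39 b)⁻¹·L·e^{(δ+ε)(ℓ+4)}·(√wZ y·|Δ(y)|·|Δ(y′)|⁻¹)·e^{−δd}‖λ‖`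
at ANY letter record whose `Q` at a configuration reading `1` is pinned to node00-def-Y's `QcoKH … parB` (the certificate's `hQco12`), block maps
`hblk12 ∕ hblkZ12`, `bI` 1-faithful. [cite: Balaban1985BackgroundPropagators, Thm 3.13 p.426, (3.13)–(3.15) p.393, (3.46) p.398, Cor. 3.5 p.407; Balaban1984PropagatorsII, (2.20) p.226, (2.60) p.234] -/
theorem blockBd_Q_one (hG : GeoOK (geo9K i)) [Fintype (geo9K i).Site] (hparB : ∀ s s', parB (fun _ _ => 1) s s' = 1)
    {U₁ : B.Cfg} (hU₁ : cfg U₁ = fun _ _ => 1)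
    {bI : FBondY i → IBondY i} (hβ1 : ∀ f : FBondY i, (geomT i.D).dist (β i.hN i.D i.hk (bI f)) (blkV1 i.hN i.D f) ≤ 1)
    (𝔬 : Ops (geo9K i) B (XBK κ i) Y (XHK κ i) W) (hblk : 𝔬.blk = blkBK i bI) (hblkZ : 𝔬.blkZ = blkHK i)
    (hQ : 𝔬.Q U₁ = QcoKH i b B cfg parB U₁) {δ : ℝ} (hδ : 0 ≤ δ) {ε : ℝ} (hε : 0 < ε)
    (hM : Real.log (geo9K i).L ≤ ε * (2 * ((ℓ : ℝ) + 1) ^ 2 - 1) * (geo9K i).M) {R₀ : ℝ} {H₀ : Prop} :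
    BlockBd (g := toB6 (geo9K i) R₀ H₀) 𝔬.blk 𝔬.blkZ (𝔬.Q U₁)
      (fun y y' => (cR39 b)⁻¹ * ((geo9K i).L * Real.exp ((δ + ε) * ((ℓ : ℝ) + 4)) *
        (Real.sqrt (((((ℓ + 1 : ℕ) : ℝ) ^ (d + 1)) ^ lvl i.hN i.D i.hk y)⁻¹) * (geo9K i).len y * ((geo9K i).len y')⁻¹) *
        Real.exp (-(δ * (geo9K i).dist y y')))) := by
  rw [hblk, hblkZ, hQ, QcoKH_one i b B cfg parB hparB hU₁]
  refine blockBd_smul_of_nonneg (G := toB6 (geo9K i) R₀ H₀) ?_ (inv_nonneg.2 (cR39_nonneg b))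
  refine blockBd_coordOpKH_of_liftY b (G := toB6 (geo9K i) R₀ H₀) (blk' := bI) (blk := fun a : IBondY i => a)
    (T := fun _ : Fin (d + 1) => Matrix.toLin' (qK i)) (fun _ J E => liftMatY_qK_liftY i J E) ?_
    fun _ => blockBd_qK_bI i hG hβ1 hδ hε hM R₀ H₀
  intro a a'; have := geo9K_one_le_L i; have := hG.lenpos a; have := hG.lenpos a'; positivity

/-- ★★★ **`Letters313L2PZ.q` AT `U = 1`, UNIFORMLY**: for every `δ ≥ 0` and every index `i` with `log L ≤ M` (the transfer threshold at `ε = 1`),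
every letter record pinned as in dag-n06-d's certificate (`hQco12`, `hblk12`, `hblkZ12`) satisfies
`BlockBd blk blkZ (Q U₁)(B₄·(cR39 b)⁻¹·(√wZ y·|Δ(y)|·|Δ(y′)|⁻¹)·e^{−δd})` with `B₄ = L·e^{(δ+1)(ℓ+4)}`.
[cite: Balaban1985BackgroundPropagators, Thm 3.13 p.426, (3.46) p.398, Cor. 3.5 p.407; Balaban1984PropagatorsII, (2.20) p.226, (2.60) p.234] -/
theorem letters313_L2_q_one_kIdx {δ : ℝ} (hδ : 0 ≤ δ) (i : KIdx d ℓ hd hL b₀ b₁) (hM : Real.log (((ℓ + 1 : ℕ) : ℝ)) ≤ (geo9K i).M)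
    (hG : GeoOK (geo9K i)) [Fintype (geo9K i).Site] (b : Module.Basis κ ℝ 𝔸) (B : B9.Backgrounds) (cfg : B.Cfg → CfgY 𝔸 i) (parB : BondParY 𝔸 i)
    (hparB : ∀ s s', parB (fun _ _ => 1) s s' = 1) {U₁ : B.Cfg} (hU₁ : cfg U₁ = fun _ _ => 1)
    {bI : FBondY i → IBondY i} (hβ1 : ∀ f : FBondY i, (geomT i.D).dist (β i.hN i.D i.hk (bI f)) (blkV1 i.hN i.D f) ≤ 1)
    (𝔬 : Ops (geo9K i) B (XBK κ i) Y (XHK κ i) W) (hblk : 𝔬.blk = blkBK i bI) (hblkZ : 𝔬.blkZ = blkHK i)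
    (hQ : 𝔬.Q U₁ = QcoKH i b B cfg parB U₁) {R₀ : ℝ} {H₀ : Prop} :
    BlockBd (g := toB6 (geo9K i) R₀ H₀) 𝔬.blk 𝔬.blkZ (𝔬.Q U₁)
      (fun y y' => ((geo9K i).L * Real.exp ((δ + 1) * ((ℓ : ℝ) + 4))) * (cR39 b)⁻¹ *
        (Real.sqrt (((((ℓ + 1 : ℕ) : ℝ) ^ (d + 1)) ^ lvl i.hN i.D i.hk y)⁻¹) * (geo9K i).len y * ((geo9K i).len y')⁻¹) *
        Real.exp (-(δ * (geo9K i).dist y y'))) := by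
  have hM1 : ((1 : ℕ) : ℝ) * Real.log (((ℓ + 1 : ℕ) : ℝ)) / 1 ≤ (geo9K i).M := by rwa [Nat.cast_one, one_mul, div_one]
  have hT := transfer_threshold i one_pos 1 hM1
  refine B9SectDL2Decay.BlockBd.mono (blockBd_Q_one i b B cfg parB hG hparB hU₁ hβ1 𝔬 hblk hblkZ hQ hδ one_pos (by simpa using hT)) fun y y' => ?_
  exact le_of_eq (by ring)

end Letter

end Literature.MathematicalPhysics.QuantumFieldTheory.Balaban1983to89.B9Letters313AtOneL2Qflat

end
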